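import Mathlib
import Summits.AtomisticToContinuum.Crystallization.Theses.PhononSlackCertificates
import Summits.AtomisticToContinuum.Crystallization.Theorems.PhononSlackCertificatesNearFieldConvexityStubSegmentCrossing
import Summits.AtomisticToContinuum.Crystallization.Theorems.PhononSlackCertificatesNearFieldConvexityStubTubeCount

/-!
# Crux `NearFieldConvexity` (stmt-AtomisticToContinuum-13958), line `Sketch`: stub `stub_pairCountOfCrossing`

PAIR COUNT AT SCALE from segment crossing + tube count: for `δ`-separated `x`, a set `Ω` of good
particles and `ℓ ≥ 4`, `Σ_{i ∈ int₄Ω} #{j ∉ Ω : |x i − x j| < 2ℓ} ≤ C(δ) ℓ⁴ #∂₄Ω`.  Charge a pair to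
the boundary particle `b` near its segment; seen from the end farther from `b` the other end lies in
a tube of radius `4` and length `9ℓ` along the ray through `x b` (`t ≥ 1/4`); count tubes
(`stub_tubeCount`, landed) and apexes (ball packing); the crossing boundary particle comes from
`stub_segmentCrossing` (landed); the elementary `pairCount_*` helpers are those of the landed
`…StubTubeCount.lean`.  This file proves the registered stub UNCONDITIONALLY.
-/

noncomputable section

open scoped BigOperators InnerProductSpace
open Literature.MathematicalPhysics.StatisticalMechanics Literature.Geometry.DiscreteGeometry

namespace Summit.AtomisticToContinuum.Crystallization.Theorems.PhononSlackNearFieldConvexity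

/-- The numeric bound `(2(2ℓ+1)/σ₁ + 1)³ · (9ℓ/4 + 2)(16/σ₂ + 1)³ ≤ 5 (6/σ₁+1)³ (16/σ₂+1)³ ℓ⁴`
for `ℓ ≥ 1`. [folklore] -/
theorem pairCount_bound_le {σ₁ σ₂ ℓ : ℝ} (hσ₁ : 0 < σ₁) (hσ₂ : 0 < σ₂) (hℓ : 1 ≤ ℓ) :
    (2 * (2 * ℓ + 1) / σ₁ + 1) ^ 3 * ((9 * ℓ / 4 + 2) * (4 * 4 / σ₂ + 1) ^ 3) ≤
      5 * (6 / σ₁ + 1) ^ 3 * (16 / σ₂ + 1) ^ 3 * ℓ ^ 4 := by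
  have h1 : 2 * (2 * ℓ + 1) / σ₁ + 1 ≤ (6 / σ₁ + 1) * ℓ := by
    rw [add_mul, div_mul_eq_mul_div, div_add_one hσ₁.ne', div_add' _ _ _ hσ₁.ne',
      div_le_div_iff_of_pos_right hσ₁]
    nlinarith
  have h2 : (2 * (2 * ℓ + 1) / σ₁ + 1) ^ 3 ≤ ((6 / σ₁ + 1) * ℓ) ^ 3 :=
    pow_le_pow_left₀ (by positivity) h1 3
  have h3 : 9 * ℓ / 4 + 2 ≤ 5 * ℓ := by linarith
  have h4 : (4 : ℝ) * 4 / σ₂ = 16 / σ₂ := by ring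
  rw [h4]
  calc (2 * (2 * ℓ + 1) / σ₁ + 1) ^ 3 * ((9 * ℓ / 4 + 2) * (16 / σ₂ + 1) ^ 3)
      ≤ ((6 / σ₁ + 1) * ℓ) ^ 3 * ((5 * ℓ) * (16 / σ₂ + 1) ^ 3) :=
        mul_le_mul h2 (mul_le_mul_of_nonneg_right h3 (by positivity)) (by positivity) (by positivity)
    _ = 5 * (6 / σ₁ + 1) ^ 3 * (16 / σ₂ + 1) ^ 3 * ℓ ^ 4 := by ring

open scoped Classical in
/-- **One-sided count.**  Fix a particle `b`, an `σ₁`-separated apex set `S₁` and a `σ₂`-separated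
target set `S₂` with all apex–target distances `≥ 4`.  The pairs `(p, q) ∈ S₁ × S₂` with
`|x p − x q| < 2ℓ`, segment within `1` of `x b`, and `q` not farther from `b` than `p`, number at most
`(2(2ℓ+1)/σ₁ + 1)³ · (9ℓ/4 + 2)(16/σ₂ + 1)³` (tubes from the apexes within `2ℓ+1` of `b`). [folklore] -/
theorem pairCount_side
    {N : ℕ} (x : Fin N → EuclideanSpace ℝ (Fin 3)) (b : Fin N) (S₁ S₂ : Finset (Fin N))
    {σ₁ σ₂ ℓ : ℝ} (hσ₁ : 0 < σ₁) (hσ₂ : 0 < σ₂) (hℓ : 4 ≤ ℓ)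
    (hsep₁ : ∀ p ∈ S₁, ∀ q ∈ S₁, p ≠ q → σ₁ ≤ dist (x p) (x q))
    (hsep₂ : ∀ p ∈ S₂, ∀ q ∈ S₂, p ≠ q → σ₂ ≤ dist (x p) (x q))
    (hfar : ∀ p ∈ S₁, ∀ q ∈ S₂, 4 ≤ dist (x p) (x q)) :
    ∑ p ∈ S₁, ((S₂.filter (fun q => dist (x p) (x q) < 2 * ℓ ∧
        (∃ t : ℝ, 0 ≤ t ∧ t ≤ 1 ∧ dist (x b) (x p + t • (x q - x p)) ≤ 1) ∧
        dist (x q) (x b) ≤ dist (x p) (x b))).card : ℝ) ≤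
      (2 * (2 * ℓ + 1) / σ₁ + 1) ^ 3 * ((9 * ℓ / 4 + 2) * (4 * 4 / σ₂ + 1) ^ 3) := by
  classical
  set T : ℝ := (9 * ℓ / 4 + 2) * (4 * 4 / σ₂ + 1) ^ 3 with hT
  have hT0 : 0 ≤ T := by positivity
  -- per apex: the filter is empty unless the apex is within `2ℓ+1` of `b`, and is a tube otherwise
  have ha : ∀ p ∈ S₁, ((S₂.filter (fun q => dist (x p) (x q) < 2 * ℓ ∧
        (∃ t : ℝ, 0 ≤ t ∧ t ≤ 1 ∧ dist (x b) (x p + t • (x q - x p)) ≤ 1) ∧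
        dist (x q) (x b) ≤ dist (x p) (x b))).card : ℝ) ≤
      if dist (x p) (x b) < 2 * ℓ + 1 then T else 0 := by
    intro p hp
    set F := S₂.filter (fun q => dist (x p) (x q) < 2 * ℓ ∧
        (∃ t : ℝ, 0 ≤ t ∧ t ≤ 1 ∧ dist (x b) (x p + t • (x q - x p)) ≤ 1) ∧
        dist (x q) (x b) ≤ dist (x p) (x b)) with hF
    by_cases hF0 : F = ∅
    · rw [hF0, Finset.card_empty, Nat.cast_zero]; split_ifs <;> linarith
    obtain ⟨q₀, hq₀⟩ := Finset.nonempty_iff_ne_empty.2 hF0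
    rw [hF, Finset.mem_filter] at hq₀
    obtain ⟨hq₀S, hr₀, ⟨t₀, ht₀0, ht₀1, hyb₀⟩, hsu₀⟩ := hq₀
    have hnear : dist (x p) (x b) < 2 * ℓ + 1 := pairCount_near_of_cross ht₀0 ht₀1 hr₀ hyb₀
    rw [if_pos hnear]
    have hs0 : 0 < dist (x p) (x b) := by
      have h4 := hfar p hp q₀ hq₀S
      have := dist_triangle (x p) (x b) (x q₀); rw [dist_comm (x b) (x q₀)] at this; linarith
    set u : EuclideanSpace ℝ (Fin 3) := (dist (x p) (x b))⁻¹ • (x b - x p) with hu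
    have hu1 : ‖u‖ = 1 := by
      rw [hu, norm_smul, norm_inv, Real.norm_of_nonneg dist_nonneg, ← dist_eq_norm,
        dist_comm (x b) (x p), inv_mul_cancel₀ hs0.ne']
    have hFsep : ∀ q ∈ F, ∀ q' ∈ F, q ≠ q' → σ₂ ≤ dist (x q) (x q') := fun q hq q' hq' hne =>
      hsep₂ q (Finset.mem_filter.1 hq).1 q' (Finset.mem_filter.1 hq').1 hne
    have hinj : Set.InjOn x ↑F := fun q hq q' hq' hqq => by
      by_contra hne; have h := hFsep q hq q' hq' hne; rw [hqq, dist_self] at h; linarith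
    have hFw : ∀ c ∈ F.image x, ∃ t : ℝ, 0 ≤ t ∧ t ≤ 9 * ℓ ∧ dist c (x p + t • u) ≤ 4 := by
      intro c hc
      obtain ⟨q, hq, rfl⟩ := Finset.mem_image.1 hc
      rw [hF, Finset.mem_filter] at hq
      obtain ⟨hqS, -, ⟨t, ht0, ht1, hyb⟩, hsu⟩ := hq
      obtain ⟨lam, hl0, hl1, hl⟩ := pairCount_tube_witness ht0 ht1 (hfar p hp q hqS) hyb hsu
      exact ⟨lam, hl0, by linarith, hl⟩
    have hsep' : ∀ c ∈ F.image x, ∀ d ∈ F.image x, c ≠ d → σ₂ ≤ dist c d := fun c hc d hd hcd => by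
      obtain ⟨q, hq, rfl⟩ := Finset.mem_image.1 hc
      obtain ⟨q', hq', rfl⟩ := Finset.mem_image.1 hd
      exact hFsep q hq q' hq' fun h => hcd (by rw [h])
    have h := stub_tubeCount (F.image x) (x p) u σ₂ 4 (9 * ℓ) hσ₂ (by norm_num) (by linarith) hu1 hFw hsep'
    rw [Finset.card_image_of_injOn hinj] at h
    rwa [hT]
  refine (Finset.sum_le_sum ha).trans ?_
  rw [← Finset.sum_filter, Finset.sum_const, nsmul_eq_mul]
  refine mul_le_mul_of_nonneg_right ?_ hT0
  exact pairCount_card_ball x _ hσ₁ (fun p hp q hq hpq => hsep₁ p (Finset.mem_filter.1 hp).1 q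
    (Finset.mem_filter.1 hq).1 hpq) (x b) (by linarith) fun p hp => le_of_lt (Finset.mem_filter.1 hp).2

/-- **Stub (geometry): PAIR COUNT AT SCALE** (unconditional: segment crossing and the tube count are
the landed `stub_segmentCrossing`, `stub_tubeCount`).  For `δ`-separated `x`, a set `Ω` of good
particles and a scale `ℓ ≥ 4`, the pairs (radius-4 interior `i`, non-member `j`) with
`|x i − x j| < 2ℓ` number at most `C(δ) ℓ⁴ #∂₄Ω`. -/
theorem stub_pairCountOfCrossing :
    ∀ δ : ℝ, 0 < δ → ∃ C : ℝ, ∀ (N : ℕ) (x : Fin N → EuclideanSpace ℝ (Fin 3)),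
      (∀ i j : Fin N, i ≠ j → δ ≤ dist (x i) (x j)) →
      ∀ Ω : Finset (Fin N), (∀ i ∈ Ω, IsTwoShellGood (1 / 20) (47 / 50) 1 x i) →
      ∀ ℓ : ℝ, 4 ≤ ℓ →
        (∑ i ∈ Ω.filter (fun i => ∀ j : Fin N, dist (x j) (x i) ≤ 4 → j ∈ Ω),
            ((Finset.univ.filter (fun j => j ∉ Ω ∧ dist (x i) (x j) < 2 * ℓ)).card : ℝ)) ≤
          C * ℓ ^ 4 * (Nat.card {i : Fin N // i ∈ Ω ∧ ∃ j : Fin N, j ∉ Ω ∧ dist (x j) (x i) ≤ 4} : ℝ) := by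
  intro δ hδ
  set r₀ : ℝ := 171 / 200 with hr₀
  have hr₀0 : 0 < r₀ := by norm_num
  refine ⟨5 * (6 / r₀ + 1) ^ 3 * (16 / δ + 1) ^ 3 + 5 * (6 / δ + 1) ^ 3 * (16 / r₀ + 1) ^ 3,
    fun N x hsep Ω hΩ ℓ hℓ => ?_⟩
  classical
  set A : Finset (Fin N) := Ω.filter (fun i => ∀ j : Fin N, dist (x j) (x i) ≤ 4 → j ∈ Ω) with hA
  set E : Finset (Fin N) := Finset.univ.filter (fun j => j ∉ Ω) with hE
  set Γs : Finset (Fin N) := Ω.filter (fun i => ∃ j : Fin N, j ∉ Ω ∧ dist (x j) (x i) ≤ 4) with hΓs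
  rw [pairCount_natCard_eq Ω (fun i => ∃ j : Fin N, j ∉ Ω ∧ dist (x j) (x i) ≤ 4)]
  have hAΩ : ∀ i ∈ A, i ∈ Ω := fun i hi => (Finset.mem_filter.1 hi).1
  have hAint : ∀ i ∈ A, ∀ k : Fin N, dist (x k) (x i) ≤ 4 → k ∈ Ω := fun i hi => (Finset.mem_filter.1 hi).2
  have hfar : ∀ i ∈ A, ∀ j : Fin N, j ∉ Ω → 4 < dist (x i) (x j) := fun i hi j hj => by
    by_contra h; exact hj (hAint i hi j (by rw [dist_comm]; exact not_lt.1 h))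
  have hsepA : ∀ i ∈ A, ∀ j ∈ A, i ≠ j → r₀ ≤ dist (x i) (x j) :=
    fun i hi j _ hij => pairCount_sep_of_good x (hΩ i (hAΩ i hi)) j (Ne.symm hij)
  have hsepE : ∀ i ∈ E, ∀ j ∈ E, i ≠ j → δ ≤ dist (x i) (x j) := fun i _ j _ hij => hsep i j hij
  have hEΩ : ∀ j ∈ E, j ∉ Ω := fun j hj => (Finset.mem_filter.1 hj).2
  -- the charging map
  set β : Fin N → Fin N → Fin N := fun i j =>
    if h : (i ∈ Ω ∧ (∀ k : Fin N, dist (x k) (x i) ≤ 4 → k ∈ Ω)) ∧ j ∉ Ω then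
      Classical.choose (stub_segmentCrossing N x Ω hΩ i h.1.1 h.1.2 j h.2) else i with hβ
  have hβspec : ∀ i ∈ A, ∀ j : Fin N, j ∉ Ω → β i j ∈ Γs ∧
      ∃ t : ℝ, 0 ≤ t ∧ t ≤ 1 ∧ dist (x (β i j)) (x i + t • (x j - x i)) ≤ 1 := by
    intro i hi j hj
    have h : (i ∈ Ω ∧ (∀ k : Fin N, dist (x k) (x i) ≤ 4 → k ∈ Ω)) ∧ j ∉ Ω := ⟨⟨hAΩ i hi, hAint i hi⟩, hj⟩
    have hb : β i j = Classical.choose (stub_segmentCrossing N x Ω hΩ i h.1.1 h.1.2 j h.2) := by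
      simp only [hβ, dif_pos h]
    have hs := Classical.choose_spec (stub_segmentCrossing N x Ω hΩ i h.1.1 h.1.2 j h.2)
    rw [hb]; exact ⟨Finset.mem_filter.2 ⟨hs.1, hs.2.1⟩, hs.2.2⟩
  set Ei : Fin N → Finset (Fin N) := fun i =>
    Finset.univ.filter (fun j => j ∉ Ω ∧ dist (x i) (x j) < 2 * ℓ) with hEi
  -- geometric predicates: `P` = pairCount_side shape from `i`, `P'` = pairCount_side shape from `j`
  set P : Fin N → Fin N → Fin N → Prop := fun b p q => dist (x p) (x q) < 2 * ℓ ∧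
      (∃ t : ℝ, 0 ≤ t ∧ t ≤ 1 ∧ dist (x b) (x p + t • (x q - x p)) ≤ 1) ∧
      dist (x q) (x b) ≤ dist (x p) (x b) with hP
  -- Step 1: fibrewise over the charged boundary particle
  have hstep1 : ∑ i ∈ A, ((Ei i).card : ℝ) =
      ∑ b ∈ Γs, ∑ i ∈ A, (((Ei i).filter (fun j => β i j = b)).card : ℝ) := by
    rw [Finset.sum_comm]
    refine Finset.sum_congr rfl fun i hi => ?_
    have hmaps : ∀ j ∈ Ei i, β i j ∈ Γs := fun j hj =>
      (hβspec i hi j (Finset.mem_filter.1 hj).2.1).1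
    exact_mod_cast Finset.card_eq_sum_card_fiberwise hmaps
  -- Step 2: per boundary particle
  set B₁ : ℝ := (2 * (2 * ℓ + 1) / r₀ + 1) ^ 3 * ((9 * ℓ / 4 + 2) * (4 * 4 / δ + 1) ^ 3) with hB₁
  set B₂ : ℝ := (2 * (2 * ℓ + 1) / δ + 1) ^ 3 * ((9 * ℓ / 4 + 2) * (4 * 4 / r₀ + 1) ^ 3) with hB₂
  have hperb : ∀ b : Fin N, ∑ i ∈ A, (((Ei i).filter (fun j => β i j = b)).card : ℝ) ≤ B₁ + B₂ := by
    intro b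
    -- split: the pair is counted from `i` (P b i j) or from `j` (P b j i)
    have hsplit : ∀ i ∈ A, (((Ei i).filter (fun j => β i j = b)).card : ℝ) ≤
        ((E.filter (fun j => P b i j)).card : ℝ) + ((E.filter (fun j => P b j i)).card : ℝ) := by
      intro i hi
      have hsub : (Ei i).filter (fun j => β i j = b) ⊆ E.filter (fun j => P b i j) ∪ E.filter (fun j => P b j i) := by
        intro j hj
        rw [Finset.mem_filter] at hj
        obtain ⟨hjEi, hjb⟩ := hj
        have hjΩ : j ∉ Ω := (Finset.mem_filter.1 hjEi).2.1
        have hr : dist (x i) (x j) < 2 * ℓ := (Finset.mem_filter.1 hjEi).2.2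
        have hjE : j ∈ E := Finset.mem_filter.2 ⟨Finset.mem_univ j, hjΩ⟩
        obtain ⟨t, ht0, ht1, hyb⟩ := (hβspec i hi j hjΩ).2
        rw [hjb] at hyb
        rcases le_or_gt (dist (x j) (x b)) (dist (x i) (x b)) with h | h
        · exact Finset.mem_union_left _ (Finset.mem_filter.2 ⟨hjE, hr, ⟨t, ht0, ht1, hyb⟩, h⟩)
        · have e : x j + (1 - t) • (x i - x j) = x i + t • (x j - x i) := by
            rw [sub_smul, one_smul, smul_sub, smul_sub]; abel
          have hr' : dist (x j) (x i) < 2 * ℓ := by rwa [dist_comm]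
          have hyb' : dist (x b) (x j + (1 - t) • (x i - x j)) ≤ 1 := by rwa [e]
          exact Finset.mem_union_right _ (Finset.mem_filter.2
            ⟨hjE, hr', ⟨1 - t, by linarith, by linarith, hyb'⟩, h.le⟩)
      exact_mod_cast (Finset.card_le_card hsub).trans (Finset.card_union_le _ _)
    -- (a) from `i`: pairCount_side with apexes `A` (r₀-separated), targets `E` (δ-separated)
    have ha : ∑ i ∈ A, ((E.filter (fun j => P b i j)).card : ℝ) ≤ B₁ :=
      pairCount_side x b A E hr₀0 hδ hℓ hsepA hsepE fun i hi j hj => (hfar i hi j (hEΩ j hj)).le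
    -- (b) from `j`: swap the sums, then pairCount_side with apexes `E`, targets `A`
    have hswap : ∑ i ∈ A, ((E.filter (fun j => P b j i)).card : ℝ) =
        ∑ j ∈ E, ((A.filter (fun i => P b j i)).card : ℝ) := by
      have h1 : ∀ i ∈ A, ((E.filter (fun j => P b j i)).card : ℝ) =
          ∑ j ∈ E, if P b j i then (1 : ℝ) else 0 := fun i _ => by rw [Finset.sum_boole]
      have h2 : ∀ j ∈ E, ((A.filter (fun i => P b j i)).card : ℝ) =
          ∑ i ∈ A, if P b j i then (1 : ℝ) else 0 := fun j _ => by rw [Finset.sum_boole]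
      rw [Finset.sum_congr rfl h1, Finset.sum_congr rfl h2, Finset.sum_comm]
    have hb : ∑ i ∈ A, ((E.filter (fun j => P b j i)).card : ℝ) ≤ B₂ := by
      rw [hswap]
      exact pairCount_side x b E A hδ hr₀0 hℓ hsepE hsepA fun j hj i hi => by
        rw [dist_comm]; exact (hfar i hi j (hEΩ j hj)).le
    calc ∑ i ∈ A, (((Ei i).filter (fun j => β i j = b)).card : ℝ)
        ≤ ∑ i ∈ A, (((E.filter (fun j => P b i j)).card : ℝ) + ((E.filter (fun j => P b j i)).card : ℝ)) :=
          Finset.sum_le_sum hsplit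
      _ ≤ B₁ + B₂ := by rw [Finset.sum_add_distrib]; exact add_le_add ha hb
  -- Step 3: sum over the boundary particles; numerics
  have htotal : ∑ i ∈ A, ((Ei i).card : ℝ) ≤ (Γs.card : ℝ) * (B₁ + B₂) := by
    rw [hstep1]
    calc ∑ b ∈ Γs, ∑ i ∈ A, (((Ei i).filter (fun j => β i j = b)).card : ℝ)
        ≤ ∑ _b ∈ Γs, (B₁ + B₂) := Finset.sum_le_sum fun b _ => hperb b
      _ = (Γs.card : ℝ) * (B₁ + B₂) := by rw [Finset.sum_const, nsmul_eq_mul]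
  have hℓ1 : (1 : ℝ) ≤ ℓ := by linarith
  have hB : B₁ + B₂ ≤ (5 * (6 / r₀ + 1) ^ 3 * (16 / δ + 1) ^ 3 +
      5 * (6 / δ + 1) ^ 3 * (16 / r₀ + 1) ^ 3) * ℓ ^ 4 := by
    have h1 := pairCount_bound_le hr₀0 hδ hℓ1
    have h2 := pairCount_bound_le hδ hr₀0 hℓ1
    rw [hB₁, hB₂]; linarith
  have hΓ0 : (0 : ℝ) ≤ Γs.card := Nat.cast_nonneg _
  calc ∑ i ∈ A, ((Ei i).card : ℝ) ≤ (Γs.card : ℝ) * (B₁ + B₂) := htotal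
    _ ≤ (Γs.card : ℝ) * ((5 * (6 / r₀ + 1) ^ 3 * (16 / δ + 1) ^ 3 +
        5 * (6 / δ + 1) ^ 3 * (16 / r₀ + 1) ^ 3) * ℓ ^ 4) := mul_le_mul_of_nonneg_left hB hΓ0
    _ = (5 * (6 / r₀ + 1) ^ 3 * (16 / δ + 1) ^ 3 + 5 * (6 / δ + 1) ^ 3 * (16 / r₀ + 1) ^ 3) * ℓ ^ 4 *
        (Γs.card : ℝ) := by ring

end Summit.AtomisticToContinuum.Crystallization.Theorems.PhononSlackNearFieldConvexity
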